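import Mathlib
import Literature.Computability.AlgebraicComplexity.OrbitClosureWeights
import Literature.Computability.AlgebraicComplexity.PlethysmStability
import Literature.Computability.Complexity.OccurrenceObstructionsBIP
import Literature.NumberTheory.DiophantineGeometry.GLHighestWeight
import Summits.ValiantsHypothesis.ValiantsHypothesis.Theorems.ValuativeGCTValuativeFlipCatalecticantHWV

/-!
# Shapes of the catalecticant corner minors; the Kadish–Landsberg filter for the padded permanent

Crux `ValuativeGCT.ValuativeFlip` (stmt-ValiantsHypothesis-12624), wall-breaker axis
"explicit padded-permanent highest-weight vectors for seedRichness" (k5 gen 1, seat 3).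

Seat 2 of this axis landed the corner minors `catMinor a b i₁ i₂ e` of the generic catalecticant as
EXPLICIT highest-weight vectors of `k[Sym^{a+b} k^σ]` of weight `catWeight a b i₁ i₂ = -(R + C)`
(`catMinor_mem_highestWeightSpace`) together with the one-determinant occurrence certificate
`one_le_orbitMultiplicity_of_catMinor_ne_zero`, and named the missing glue to the crux's currency:
the tail stub speaks of `partitionWeightLex m λ` for a partition `λ ⊢ m·δ` with `≤ m²` parts.  This
file supplies that glue and the first constraint on the family for the padded permanent:

* the exponent-sum calculus of final-segment monomials: `expSum c i₀ l = 0` below the segment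
  (`expSum_eq_zero_of_lt`), constant on it (`expSum_eq_of_le`, a transposition of two segment
  variables permutes the segment monomials), monotone in `l`, `Σ_l expSum = c · D`
  (`sum_expSum`, `D` = number of segment monomials) and `N · expSum = c · D` on the segment
  (`card_mul_expSum`, `N` = length of the segment);
* `catWeight` is nonpositive, dominant (antitone) and of size `-(a+b)·D`
  (`catWeight_nonpos`, `catWeight_antitone`, `size_catWeight`);
* every nonpositive antitone weight on `MatIdx m` of size `-(d·D)` is `partitionWeightLex m λ` for a
  `λ ⊢ d·D` with `≤ m²` parts (`exists_partitionWeightLex_eq_of_antitone`), whence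
  `catWeight a b i₁ i₂ = partitionWeightLex m λ`, `λ ⊢ (a+b)·D` (`exists_partitionWeightLex_eq_catWeight`):
  the two-step shape `((R+C)^{N_min}, R^{N_max - N_min})`, of LENGTH the longer segment;
* the corner-minor certificate in the tail stub's currency (`exists_partition_certificate_of_catMinor_ne_zero`);
* **the Kadish–Landsberg filter** (`min_card_mul_sub_le_of_hasHighestWeight_catWeight`): if the
  weight of a corner minor occurs at all in `ℂ[Δ_m(X₀₀^{m-n} per_n)]` then
  `min(N₁, N₂) · (m - n) ≤ m` — in the tail of the window (`6n < 5m`) the SHORTER of the two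
  segments has at most `5` variables (`min_card_le_five_of_tail`).  So a catalecticant certificate
  for the padded permanent of growing length must put its length on the longer segment with small
  parts `R = aD/N₁`; Cruxes/ValuativeFlip/AxisK5G1S3CatalecticantShapes.md records why those minors
  (row degree `a < m - n` on a segment of `≥ 2` variables) vanish identically on `End · pp`.
[Fulton–Harris §15.5; BLMW 2011 (5.2.2); BIP 2019 Thm. 4.9(2) (Kadish–Landsberg); folklore]
-/

set_option linter.dupNamespace false

namespace Summit.ValiantsHypothesis.ValiantsHypothesis.Theorems.ValuativeFlip

open MvPolynomial
open scoped BigOperators Matrix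
open Literature.Computability.AlgebraicComplexity
open Literature.Computability.Complexity
open Literature.NumberTheory.DiophantineGeometry

noncomputable section

/-! ### The exponent-sum calculus of final-segment monomials -/

section ExpSum

variable {σ : Type*} [Fintype σ] [LinearOrder σ]

/-- A final-segment monomial has exponent `0` at every variable below the segment. [folklore] -/
theorem upIdx_vec_apply_eq_zero_of_lt {c : ℕ} {i₀ l : σ} (h : l < i₀) (r : UpIdx σ c i₀) :
    r.vec l = 0 := by
  by_contra hne
  exact absurd (r.supp l (Finsupp.mem_support_iff.mpr hne)) (not_le.mpr h)

/-- The exponent sum vanishes below the segment: `expSum c i₀ l = 0` for `l < i₀`. [folklore] -/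
theorem expSum_eq_zero_of_lt {c : ℕ} {i₀ l : σ} (h : l < i₀) : expSum c i₀ l = 0 :=
  Finset.sum_eq_zero fun r _ => upIdx_vec_apply_eq_zero_of_lt h r

/-- A final-segment monomial of `UpIdx σ c i₀` has degree `c`. [folklore] -/
theorem degree_upIdx_vec {c : ℕ} {i₀ : σ} (r : UpIdx σ c i₀) : r.vec.degree = c :=
  mem_degMonomials_iff.mp r.1.2

/-- **Total exponent sum**: `Σ_l expSum c i₀ l = c · D`, `D` the number of final-segment monomials
of degree `c` (each monomial has degree `c`). [folklore] -/
theorem sum_expSum (c : ℕ) (i₀ : σ) :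
    ∑ l, expSum c i₀ l = c * Fintype.card (UpIdx σ c i₀) := by
  unfold expSum
  rw [Finset.sum_comm]
  have h : ∀ r : UpIdx σ c i₀, ∑ l, r.vec l = c := fun r => by
    rw [← Finsupp.degree_eq_sum]; exact degree_upIdx_vec r
  simp only [h, Finset.sum_const, Finset.card_univ, smul_eq_mul, mul_comm]

/-- **Symmetry on the segment**: `expSum c i₀ l = expSum c i₀ l'` for `l, l' ≥ i₀` — the
transposition of the variables `l, l'` permutes the final-segment monomials of degree `c` and
exchanges the exponents at `l` and `l'`. [folklore] -/
theorem expSum_eq_of_le {c : ℕ} {i₀ l l' : σ} (hl : i₀ ≤ l) (hl' : i₀ ≤ l') :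
    expSum c i₀ l = expSum c i₀ l' := by
  classical
  set s : Equiv.Perm σ := Equiv.swap l l' with hs
  have hdeg : ∀ v : σ →₀ ℕ, (Finsupp.equivMapDomain s v).degree = v.degree := fun v => by
    rw [Finsupp.degree_eq_sum, Finsupp.degree_eq_sum]
    simp only [Finsupp.equivMapDomain_apply]
    exact Fintype.sum_equiv s.symm _ _ (fun _ => rfl)
  have hsupp : ∀ r : UpIdx σ c i₀, ∀ i ∈ (Finsupp.equivMapDomain s r.vec).support, i₀ ≤ i := by
    intro r i hi
    rw [Finsupp.mem_support_iff, Finsupp.equivMapDomain_apply] at hi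
    have h1 := r.supp _ (Finsupp.mem_support_iff.mpr hi)
    by_cases h2 : i = l
    · exact h2 ▸ hl
    by_cases h3 : i = l'
    · exact h3 ▸ hl'
    · rwa [hs, Equiv.symm_swap, Equiv.swap_apply_of_ne_of_ne h2 h3] at h1
  let F : UpIdx σ c i₀ → UpIdx σ c i₀ := fun r =>
    ⟨⟨Finsupp.equivMapDomain s r.vec,
      mem_degMonomials_iff.mpr ((hdeg r.vec).trans (degree_upIdx_vec r))⟩, hsupp r⟩
  have hFvec : ∀ r, (F r).vec = Finsupp.equivMapDomain s r.vec := fun _ => rfl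
  have hF : Function.Involutive F := fun r => by
    apply UpIdx.vec_injective
    rw [hFvec, hFvec]
    ext i
    rw [Finsupp.equivMapDomain_apply, Finsupp.equivMapDomain_apply, hs, Equiv.symm_swap,
      Equiv.swap_apply_self]
  calc expSum c i₀ l = ∑ r : UpIdx σ c i₀, (F r).vec l' := Finset.sum_congr rfl fun r _ => by
          rw [hFvec, Finsupp.equivMapDomain_apply, hs, Equiv.symm_swap, Equiv.swap_apply_right]
    _ = ∑ r : UpIdx σ c i₀, r.vec l' := hF.bijective.sum_comp (fun r : UpIdx σ c i₀ => r.vec l')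
    _ = expSum c i₀ l' := rfl

/-- The exponent sum is monotone in the variable: `0` below the segment, constant on it. [folklore] -/
theorem expSum_monotone (c : ℕ) (i₀ : σ) : Monotone (expSum c i₀) := by
  intro l l' hll'
  by_cases hl : i₀ ≤ l
  · exact (expSum_eq_of_le hl (hl.trans hll')).le
  · rw [expSum_eq_zero_of_lt (not_le.mp hl)]
    exact Nat.zero_le _

/-- **The value on the segment**: `N · expSum c i₀ l = c · D` for `l ≥ i₀`, `N` the number of
variables of the segment and `D` the number of its degree-`c` monomials (so `expSum = cD/N`, the
classical `C(N+c-1, c-1)`). [folklore] -/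
theorem card_mul_expSum {c : ℕ} {i₀ l : σ} (hl : i₀ ≤ l) :
    Fintype.card {i : σ // i₀ ≤ i} * expSum c i₀ l = c * Fintype.card (UpIdx σ c i₀) := by
  classical
  rw [← sum_expSum c i₀, Fintype.card_subtype,
    ← Finset.sum_filter_add_sum_filter_not Finset.univ (fun i => i₀ ≤ i) (expSum c i₀),
    Finset.sum_const_nat (m := expSum c i₀ l)
      (fun l' hl' => expSum_eq_of_le (Finset.mem_filter.mp hl').2 hl),
    Finset.sum_eq_zero (fun l' hl' => expSum_eq_zero_of_lt (not_le.mp (Finset.mem_filter.mp hl').2)),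
    add_zero]

/-- The segment of a variable `l ≥ i₀` is nonempty, and it has a degree-`c` monomial (`X_l^c`):
`1 ≤ D`. [folklore] -/
theorem card_upIdx_pos (c : ℕ) {i₀ l : σ} (hl : i₀ ≤ l) : 0 < Fintype.card (UpIdx σ c i₀) := by
  classical
  refine Fintype.card_pos_iff.mpr ⟨⟨⟨Finsupp.single l c, mem_degMonomials_iff.mpr (Finsupp.degree_single l c)⟩, ?_⟩⟩
  intro i hi
  rw [Finset.mem_singleton.mp (Finsupp.support_single_subset hi)]
  exact hl

/-! ### The weight of a corner minor: nonpositive, dominant, of size `-(a+b)·D` -/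

/-- Unfolding of `catWeight`. [folklore] -/
theorem catWeight_apply (a b : ℕ) (i₁ i₂ l : σ) :
    catWeight (σ := σ) a b i₁ i₂ l = -((expSum a i₁ l + expSum b i₂ l : ℕ) : ℤ) := rfl

/-- `catWeight` is nonpositive (a weight of a coordinate ring). [folklore] -/
theorem catWeight_nonpos (a b : ℕ) (i₁ i₂ : σ) : ∀ l, catWeight (σ := σ) a b i₁ i₂ l ≤ 0 := fun l => by
  rw [catWeight_apply, neg_nonpos]
  exact Nat.cast_nonneg _

/-- `catWeight` is dominant for the upper triangular Borel subgroup (weakly decreasing along the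
variable order), since both exponent sums are monotone. [folklore] -/
theorem catWeight_antitone (a b : ℕ) (i₁ i₂ : σ) : Antitone (catWeight (σ := σ) a b i₁ i₂) := by
  intro l l' h
  have h' : expSum a i₁ l + expSum b i₂ l ≤ expSum a i₁ l' + expSum b i₂ l' :=
    add_le_add (expSum_monotone a i₁ h) (expSum_monotone b i₂ h)
  rw [catWeight_apply, catWeight_apply]
  exact neg_le_neg (by exact_mod_cast h')

/-- **Size of the corner weight**: `|catWeight a b i₁ i₂| = -(a+b)·D`, `D` = number of rows
(= number of columns, through `e`) of the corner: the degree of the corner minor is `D`, in the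
forms of degree `a + b`. [folklore] -/
theorem size_catWeight (a b : ℕ) (i₁ i₂ : σ) (e : UpIdx σ a i₁ ≃ UpIdx σ b i₂) :
    (catWeight (σ := σ) a b i₁ i₂).size = -(((a + b) * Fintype.card (UpIdx σ a i₁) : ℕ) : ℤ) := by
  rw [Weight.size]
  simp only [catWeight_apply, Finset.sum_neg_distrib, Nat.cast_add, Finset.sum_add_distrib]
  rw [← Nat.cast_sum, ← Nat.cast_sum, sum_expSum, sum_expSum, ← Fintype.card_congr e]
  push_cast
  ring

end ExpSum

/-! ### From weights to shapes on the matrix space `MatIdx m` -/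

section Shapes

variable {m : ℕ}

/-- **Antitone nonpositive weights are dual partition weights.**  On the lexicographically ordered
matrix variables `MatIdx m`, a weight `χ ≤ 0`, weakly decreasing, of size `-(d·D)` is
`partitionWeightLex m λ = (λ*)` for a (unique) partition `λ ⊢ d·D` with at most `m²` parts
(`λ` read off in reverse: the greatest variable carries `-λ₁`).  BLMW 2011 (5.2.2);
Fulton–Harris §15.5. [folklore] -/
theorem exists_partitionWeightLex_eq_of_antitone {d D : ℕ} (χ : Weight (MatIdx m))
    (h0 : ∀ l, χ l ≤ 0) (hanti : Antitone χ) (hsize : χ.size = -((d * D : ℕ) : ℤ)) :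
    ∃ lam : Nat.Partition (d * D), lam.parts.card ≤ m * m ∧ partitionWeightLex m lam = χ := by
  obtain ⟨lam, hcard, hlam⟩ :=
    Weight.exists_eq_dualOfPartition_comp_of_nonpos (matIdxEquiv m) χ h0 hanti hsize
  refine ⟨⟨lam.parts, lam.parts_pos, by rw [lam.parts_sum, mul_comm]⟩, hcard, ?_⟩
  rw [hlam]
  rfl

/-- **The shape of a corner minor.**  `catWeight a b i₁ i₂ = partitionWeightLex m λ` for a partition
`λ ⊢ (a+b)·D` with at most `m²` parts (`D` = size of the corner): the two-step shape with `N_min`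
parts `R + C` and `N_max - N_min` parts `R` (or `C`), `N₁, N₂` the lengths of the two final
segments, `R = aD/N₁`, `C = bD/N₂` (`card_mul_expSum`); its LENGTH is the longer segment.  This is
the bookkeeping that lets the corner minors (`catMinor_mem_highestWeightSpace`) serve as the `F_i`
of the crux's tail certificates (`partitionWeightLex`-currency). [folklore] -/
theorem exists_partitionWeightLex_eq_catWeight (a b : ℕ) (i₁ i₂ : MatIdx m)
    (e : UpIdx (MatIdx m) a i₁ ≃ UpIdx (MatIdx m) b i₂) :
    ∃ lam : Nat.Partition ((a + b) * Fintype.card (UpIdx (MatIdx m) a i₁)),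
      lam.parts.card ≤ m * m ∧ partitionWeightLex m lam = catWeight a b i₁ i₂ :=
  exists_partitionWeightLex_eq_of_antitone _ (catWeight_nonpos a b i₁ i₂) (catWeight_antitone a b i₁ i₂)
    (size_catWeight a b i₁ i₂ e)

/-- **The first part of the shape** is read at the greatest variable: for any `λ` with
`partitionWeightLex m λ = χ`, `λ₁ = -χ(topMatIdx m)`. [folklore] -/
theorem sup_parts_eq_neg_apply_topMatIdx [NeZero m] {N : ℕ} (lam : Nat.Partition N) (χ : Weight (MatIdx m))
    (h : partitionWeightLex m lam = χ) : ((lam.parts.sup : ℕ) : ℤ) = -χ (topMatIdx m) := by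
  have hmm : 0 < m * m := Nat.pos_of_ne_zero (mul_ne_zero (NeZero.ne m) (NeZero.ne m))
  rw [← h, partitionWeightLex, Weight.toMatIdx, topMatIdx, OrderIso.symm_apply_apply,
    Weight.dualOfPartition_apply_last lam hmm, sup_parts_eq_getD_sortedParts, neg_neg]

/-- For the corner weight: `λ₁ = R_top + C_top = expSum a i₁ top + expSum b i₂ top`. [folklore] -/
theorem sup_parts_eq_expSum_add [NeZero m] {N : ℕ} (lam : Nat.Partition N) (a b : ℕ) (i₁ i₂ : MatIdx m)
    (h : partitionWeightLex m lam = catWeight a b i₁ i₂) :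
    lam.parts.sup = expSum a i₁ (topMatIdx m) + expSum b i₂ (topMatIdx m) := by
  have h1 := sup_parts_eq_neg_apply_topMatIdx lam _ h
  rw [catWeight_apply, neg_neg] at h1
  exact_mod_cast h1

end Shapes

/-! ### Certificates in the currency of the tail stub -/

section Certificates

/-- **A corner-minor certificate in partition currency.**  If ONE matrix `A` (singular allowed)
makes the corner block of the catalecticant of `A · f` nonsingular, then for the explicit shape
`λ ⊢ (a+b)·D` of the corner (`≤ m²` parts, `partitionWeightLex m λ = catWeight a b i₁ i₂`) the
multiplicity of `λ*` in `ℂ[Δ_{a+b}(f)]` is at least `1` — the `D = 1`, outer-kind instance of the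
tail stub's certificate format, for any form `f` in the matrix variables (e.g.
`f = paddedPerFormLex ℂ n (a+b)`). [this crux (PE1); folklore] -/
theorem exists_partition_certificate_of_catMinor_ne_zero {m : ℕ} (f : MvPolynomial (MatIdx m) ℂ)
    (a b : ℕ) (hab : a + b ≠ 0) (i₁ i₂ : MatIdx m) (e : UpIdx (MatIdx m) a i₁ ≃ UpIdx (MatIdx m) b i₂)
    (A : Matrix (MatIdx m) (MatIdx m) ℂ)
    (hA : (catMinorMat a b i₁ i₂ e (linSubst (MatIdx m) ℂ A f)).det ≠ 0) :
    ∃ lam : Nat.Partition ((a + b) * Fintype.card (UpIdx (MatIdx m) a i₁)),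
      lam.parts.card ≤ m * m ∧ partitionWeightLex m lam = catWeight a b i₁ i₂ ∧
      catMinor a b i₁ i₂ e ∈ highestWeightSpace (coordRep (MatIdx m) ℂ (a + b)) (partitionWeightLex m lam) ∧
      1 ≤ orbitMultiplicity ℂ f (a + b) (partitionWeightLex m lam) := by
  obtain ⟨lam, hcard, hlam⟩ := exists_partitionWeightLex_eq_catWeight a b i₁ i₂ e
  refine ⟨lam, hcard, hlam, ?_, ?_⟩
  · rw [hlam]; exact catMinor_mem_highestWeightSpace a b i₁ i₂ e
  · rw [hlam]; exact one_le_orbitMultiplicity_of_catMinor_ne_zero f a b hab i₁ i₂ e A hA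

end Certificates

/-! ### The Kadish–Landsberg filter for corner weights of the padded permanent -/

section Filter

/-- **The Kadish–Landsberg filter for catalecticant weights.**  If the weight
`catWeight a b i₁ i₂` (`a + b = m`) of a corner of size `D` occurs at all in the coordinate ring of
the orbit closure of the padded permanent `X₀₀^{m-n} per_n` (by the corner minor itself or by any
other highest-weight vector), then `min(N₁, N₂) · (m - n) ≤ m`, `N₁, N₂` the lengths of the two
final segments.  Proof: Kadish–Landsberg (`kadish_landsberg_padding_holds`) gives
`λ₁ ≥ D (m - n)` for the shape `λ ⊢ m·D` of the weight, while `λ₁ = R_top + C_top` with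
`N₁ R_top = a D`, `N₂ C_top = b D` (`card_mul_expSum`), so
`N_min · D (m - n) ≤ N_min (R_top + C_top) ≤ N₁ R_top + N₂ C_top = (a + b) D = m D`.
[BIP 2019 Thm. 4.9(2); Kadish–Landsberg 2014; folklore] -/
theorem min_card_mul_sub_le_of_hasHighestWeight_catWeight (n m a b : ℕ) [NeZero m] (hnm : n ≤ m)
    (hab : a + b = m) (i₁ i₂ : MatIdx m) (e : UpIdx (MatIdx m) a i₁ ≃ UpIdx (MatIdx m) b i₂)
    (h : HasHighestWeight (orbitCoordRep (paddedPerFormLex ℂ n m) m) (catWeight a b i₁ i₂)) :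
    min (Fintype.card {l : MatIdx m // i₁ ≤ l}) (Fintype.card {l : MatIdx m // i₂ ≤ l}) * (m - n) ≤ m := by
  have hDpos : 0 < Fintype.card (UpIdx (MatIdx m) a i₁) := card_upIdx_pos a (le_topMatIdx m i₁)
  have h₁ := card_mul_expSum (c := a) (le_topMatIdx m i₁)
  have h₂ := card_mul_expSum (c := b) (le_topMatIdx m i₂)
  have hex := exists_partitionWeightLex_eq_catWeight a b i₁ i₂ e
  rw [← Fintype.card_congr e] at h₂
  -- name the size of the corner (keeps `Fintype.card` out of definitional unfolding)
  obtain ⟨D, hD⟩ : ∃ D, Fintype.card (UpIdx (MatIdx m) a i₁) = D := ⟨_, rfl⟩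
  rw [hD] at hDpos h₁ h₂ hex
  rw [hab, Nat.mul_comm m D] at hex
  obtain ⟨pi, hcard, hpi⟩ := hex
  -- Kadish–Landsberg: `D (m - n) ≤ λ₁`
  have hocc : HasHighestWeight (paddedPerOrbitRep ℂ n m) (partitionWeightLex m pi) := by
    rw [hpi]; exact h
  have hKL : D * (m - n) ≤ pi.parts.sup := kadish_landsberg_padding_holds n m D hnm pi hcard hocc
  -- `λ₁ = R_top + C_top`
  rw [sup_parts_eq_expSum_add pi a b i₁ i₂ hpi] at hKL
  set N₁ := Fintype.card {l : MatIdx m // i₁ ≤ l}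
  set N₂ := Fintype.card {l : MatIdx m // i₂ ≤ l}
  set R := expSum a i₁ (topMatIdx m)
  set C := expSum b i₂ (topMatIdx m)
  have key : min N₁ N₂ * (m - n) * D ≤ m * D :=
    calc min N₁ N₂ * (m - n) * D = min N₁ N₂ * (D * (m - n)) := by ring
      _ ≤ min N₁ N₂ * (R + C) := Nat.mul_le_mul_left _ hKL
      _ = min N₁ N₂ * R + min N₁ N₂ * C := by ring
      _ ≤ N₁ * R + N₂ * C := add_le_add (Nat.mul_le_mul_right _ (min_le_left _ _))
          (Nat.mul_le_mul_right _ (min_le_right _ _))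
      _ = a * D + b * D := by rw [h₁, h₂]
      _ = m * D := by rw [← Nat.add_mul, hab]
  exact Nat.le_of_mul_le_mul_right key hDpos

/-- **In the tail the short segment has at most five variables.**  Above the linear head of the
window (`6 n < 5 m`, so `m < 6 (m - n)`), a catalecticant corner weight occurring for the padded
permanent has `min(N₁, N₂) ≤ 5`. [this crux (four-row-count line, slope 6/5); folklore] -/
theorem min_card_le_five_of_tail (n m a b : ℕ) [NeZero m] (hnm : n ≤ m) (htail : 6 * n < 5 * m)
    (hab : a + b = m) (i₁ i₂ : MatIdx m) (e : UpIdx (MatIdx m) a i₁ ≃ UpIdx (MatIdx m) b i₂)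
    (h : HasHighestWeight (orbitCoordRep (paddedPerFormLex ℂ n m) m) (catWeight a b i₁ i₂)) :
    min (Fintype.card {l : MatIdx m // i₁ ≤ l}) (Fintype.card {l : MatIdx m // i₂ ≤ l}) ≤ 5 := by
  have hle := min_card_mul_sub_le_of_hasHighestWeight_catWeight n m a b hnm hab i₁ i₂ e h
  set N := min (Fintype.card {l : MatIdx m // i₁ ≤ l}) (Fintype.card {l : MatIdx m // i₂ ≤ l})
  by_contra hN
  have h6 : 6 ≤ N := by omega
  have h1 : 6 * (m - n) ≤ N * (m - n) := Nat.mul_le_mul_right _ h6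
  omega

/-- **The filter for an actual corner-minor certificate.**  If one matrix `A` makes the corner
block of the catalecticant of `A · (X₀₀^{m-n} per_n)` nonsingular (`m = a + b`), then
`min(N₁, N₂) · (m - n) ≤ m`. [BIP 2019 Thm. 4.9(2); this crux (PE1); folklore] -/
theorem min_card_mul_sub_le_of_catMinor_ne_zero (n a b : ℕ) [NeZero (a + b)] (hnm : n ≤ a + b)
    (i₁ i₂ : MatIdx (a + b)) (e : UpIdx (MatIdx (a + b)) a i₁ ≃ UpIdx (MatIdx (a + b)) b i₂)
    (A : Matrix (MatIdx (a + b)) (MatIdx (a + b)) ℂ)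
    (hA : (catMinorMat a b i₁ i₂ e (linSubst (MatIdx (a + b)) ℂ A (paddedPerFormLex ℂ n (a + b)))).det ≠ 0) :
    min (Fintype.card {l : MatIdx (a + b) // i₁ ≤ l}) (Fintype.card {l : MatIdx (a + b) // i₂ ≤ l}) *
      (a + b - n) ≤ a + b := by
  have h1 := one_le_orbitMultiplicity_of_catMinor_ne_zero (paddedPerFormLex ℂ n (a + b)) a b (NeZero.ne (a + b))
    i₁ i₂ e A hA
  refine min_card_mul_sub_le_of_hasHighestWeight_catWeight n (a + b) a b hnm rfl i₁ i₂ e ?_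
  intro hbot
  have h0 : orbitMultiplicity ℂ (paddedPerFormLex ℂ n (a + b)) (a + b) (catWeight a b i₁ i₂) = 0 := by
    rw [orbitMultiplicity, hwMultiplicity]
    change Module.finrank ℂ ↥(highestWeightSpace (orbitCoordRep (paddedPerFormLex ℂ n (a + b)) (a + b)) (catWeight a b i₁ i₂)) = 0
    rw [hbot, finrank_bot]
  omega

/-- **Registered form of the Kadish–Landsberg filter** (one-line `∀` signature, stub
`catWeight_paddedPer_filter` of stmt-ValiantsHypothesis-12624): a catalecticant corner weight
occurring for the padded permanent has `min(N₁, N₂) · (m - n) ≤ m`.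
[BIP 2019 Thm. 4.9(2); Kadish–Landsberg 2014; this crux] -/
theorem catWeight_paddedPer_filter :
    ∀ (n m a b : ℕ) [NeZero m], n ≤ m → a + b = m → ∀ (i₁ i₂ : MatIdx m) (_e : UpIdx (MatIdx m) a i₁ ≃ UpIdx (MatIdx m) b i₂), HasHighestWeight (orbitCoordRep (paddedPerFormLex ℂ n m) m) (catWeight a b i₁ i₂) → min (Fintype.card {l : MatIdx m // i₁ ≤ l}) (Fintype.card {l : MatIdx m // i₂ ≤ l}) * (m - n) ≤ m :=
  fun n m a b _ hnm hab i₁ i₂ e h =>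
    min_card_mul_sub_le_of_hasHighestWeight_catWeight n m a b hnm hab i₁ i₂ e h

end Filter

end

end Summit.ValiantsHypothesis.ValiantsHypothesis.Theorems.ValuativeFlip
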